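import Mathlib.Analysis.SpecialFunctions.Exp
import Mathlib.Analysis.SpecialFunctions.Pow.Real
import HarnessLib

/-!
# K1L_D (stmt-AnomalousDissipation-27980): (V_mod) flat stage, block (ss) — GEOMETRIC MAJORANTS for the grid iteration (pure real bookkeeping)
(helper; `--supports 27980 --as helper`; prover ad-sawtooth-k1loc-p1 g15; companion of `…VmodIterate` (`iterate_defect_le`), row «C / coarse / y ≥ 1»
of the certifier's table `Cruxes/LagrangianRenormalisationStep/Lines/onelevel-ss-regimes.md`.)

The recursion of `iterate_defect_le` — `A (j+1) ≥ (θ+cV)·A j + cL·F j`, `F (j+1) ≥ √2·cS·A j + (cS+κ)·F j`, `D (j+1) ≥ cV·A j + cL·F j + θ·D j` —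
is majorised by `A j = F j = ρ^j·a₀`, `D j = (cV+cL)·j·ρ^(j−1)·a₀` with `ρ = θ + cV + cL + 3·cS + κ` (`geomA_rec`, `geomF_rec`, `geomD_rec`),
and then the window bound reads `cV·A j + cL·F j + D j ≤ (cV+cL)·(j+1)·ρ^(j−1)·a₀` (`geom_window_le`, `ρ ≤ 1`).
The polynomial-times-geometric factor is bounded explicitly: `(j+1)²·ρ^(j−1) ≤ 9 + 16/(1−ρ)²` for `0 ≤ ρ < 1`, `j ≥ 1` (`sq_mul_pow_le`;
`ρ ≤ exp(ρ−1)` and `u·exp(−u) ≤ 1`, inlined).  `sorry`-free; NOT a proof of (ss), of the stub, of K1L_D or of AD; rung F-D1.A0.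
-/

set_option linter.dupNamespace false

noncomputable section

namespace Summit.AnomalousDissipation.AnomalousDissipation.Theorems.SolenoidalFractalHomogenisation.LagrangianStep.VmodGen

/-! ## §1 The geometric majorants satisfy the recursion -/

section Majorants

variable {θ cV cL cS κ a₀ : ℝ}

/-- `A`-recursion: `(θ+cV)·ρ^j a₀ + cL·ρ^j a₀ ≤ ρ^(j+1) a₀` for `ρ = θ + cV + cL + 3cS + κ` (all constants `≥ 0`). -/
theorem geomA_rec (hθ : 0 ≤ θ) (hcV : 0 ≤ cV) (hcL : 0 ≤ cL) (hcS : 0 ≤ cS) (hκ : 0 ≤ κ) (ha₀ : 0 ≤ a₀) (j : ℕ) :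
    (θ + cV) * ((θ + cV + cL + 3 * cS + κ) ^ j * a₀) + cL * ((θ + cV + cL + 3 * cS + κ) ^ j * a₀)
      ≤ (θ + cV + cL + 3 * cS + κ) ^ (j + 1) * a₀ := by
  have hρ : 0 ≤ θ + cV + cL + 3 * cS + κ := by positivity
  have hp : 0 ≤ (θ + cV + cL + 3 * cS + κ) ^ j * a₀ := mul_nonneg (pow_nonneg hρ j) ha₀
  rw [pow_succ]
  nlinarith

/-- `F`-recursion: `√2·cS·ρ^j a₀ + (cS+κ)·ρ^j a₀ ≤ ρ^(j+1) a₀` (`1 + √2 ≤ 3`). -/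
theorem geomF_rec (hθ : 0 ≤ θ) (hcV : 0 ≤ cV) (hcL : 0 ≤ cL) (hcS : 0 ≤ cS) (hκ : 0 ≤ κ) (ha₀ : 0 ≤ a₀) (j : ℕ) :
    Real.sqrt 2 * cS * ((θ + cV + cL + 3 * cS + κ) ^ j * a₀) + (cS + κ) * ((θ + cV + cL + 3 * cS + κ) ^ j * a₀)
      ≤ (θ + cV + cL + 3 * cS + κ) ^ (j + 1) * a₀ := by
  have hρ : 0 ≤ θ + cV + cL + 3 * cS + κ := by positivity
  have hp : 0 ≤ (θ + cV + cL + 3 * cS + κ) ^ j * a₀ := mul_nonneg (pow_nonneg hρ j) ha₀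
  have hs2 : Real.sqrt 2 ≤ 2 := by
    rw [show (2:ℝ) = Real.sqrt 4 by rw [show (4:ℝ) = 2 ^ 2 by norm_num, Real.sqrt_sq (by norm_num)]]
    exact Real.sqrt_le_sqrt (by norm_num)
  rw [pow_succ]
  nlinarith [mul_nonneg hcS hp, mul_le_mul_of_nonneg_right hs2 (mul_nonneg hcS hp)]

/-- `D`-recursion: `cV·ρ^j a₀ + cL·ρ^j a₀ + θ·((cV+cL)·j·ρ^(j−1)·a₀) ≤ (cV+cL)·(j+1)·ρ^j·a₀` (uses `θ ≤ ρ`). -/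
theorem geomD_rec (hθ : 0 ≤ θ) (hcV : 0 ≤ cV) (hcL : 0 ≤ cL) (hcS : 0 ≤ cS) (hκ : 0 ≤ κ) (ha₀ : 0 ≤ a₀) (j : ℕ) :
    cV * ((θ + cV + cL + 3 * cS + κ) ^ j * a₀) + cL * ((θ + cV + cL + 3 * cS + κ) ^ j * a₀)
        + θ * ((cV + cL) * j * (θ + cV + cL + 3 * cS + κ) ^ (j - 1) * a₀)
      ≤ (cV + cL) * ((j + 1 : ℕ) : ℝ) * (θ + cV + cL + 3 * cS + κ) ^ (j + 1 - 1) * a₀ := by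
  set ρ := θ + cV + cL + 3 * cS + κ with hρdef
  have hρ : 0 ≤ ρ := by positivity
  have hθρ : θ ≤ ρ := by rw [hρdef]; linarith
  rw [Nat.add_sub_cancel]
  push_cast
  rcases Nat.eq_zero_or_pos j with hj | hj
  · subst hj
    simp only [Nat.cast_zero, mul_zero, zero_mul, add_zero, pow_zero, mul_one, zero_add]
    linarith
  · -- `θ·ρ^(j-1) ≤ ρ^j`
    have hpow : θ * ρ ^ (j - 1) ≤ ρ ^ j := by
      calc θ * ρ ^ (j - 1) ≤ ρ * ρ ^ (j - 1) := mul_le_mul_of_nonneg_right hθρ (pow_nonneg hρ _)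
        _ = ρ ^ j := by rw [← pow_succ', Nat.sub_add_cancel hj]
    have hcVL : 0 ≤ cV + cL := by positivity
    have hj0 : (0:ℝ) ≤ j := Nat.cast_nonneg j
    have h1 : θ * ((cV + cL) * j * ρ ^ (j - 1) * a₀) ≤ (cV + cL) * j * ρ ^ j * a₀ := by
      have := mul_le_mul_of_nonneg_left hpow (mul_nonneg (mul_nonneg hcVL hj0) ha₀)
      nlinarith
    nlinarith [mul_nonneg (pow_nonneg hρ j) ha₀]

/-- The window bound: `cV·ρ^j a₀ + cL·ρ^j a₀ + (cV+cL)·j·ρ^(j−1)·a₀ ≤ (cV+cL)·(j+1)·ρ^(j−1)·a₀` when `ρ ≤ 1`. -/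
theorem geom_window_le (hθ : 0 ≤ θ) (hcV : 0 ≤ cV) (hcL : 0 ≤ cL) (hcS : 0 ≤ cS) (hκ : 0 ≤ κ) (ha₀ : 0 ≤ a₀)
    (hρ1 : θ + cV + cL + 3 * cS + κ ≤ 1) (j : ℕ) :
    cV * ((θ + cV + cL + 3 * cS + κ) ^ j * a₀) + cL * ((θ + cV + cL + 3 * cS + κ) ^ j * a₀)
        + (cV + cL) * j * (θ + cV + cL + 3 * cS + κ) ^ (j - 1) * a₀
      ≤ (cV + cL) * ((j : ℝ) + 1) * (θ + cV + cL + 3 * cS + κ) ^ (j - 1) * a₀ := by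
  set ρ := θ + cV + cL + 3 * cS + κ with hρdef
  have hρ : 0 ≤ ρ := by positivity
  -- `ρ^j ≤ ρ^(j-1)`
  have hpow : ρ ^ j ≤ ρ ^ (j - 1) := by
    rcases Nat.eq_zero_or_pos j with hj | hj
    · subst hj; simp
    · calc ρ ^ j = ρ * ρ ^ (j - 1) := by rw [← pow_succ', Nat.sub_add_cancel hj]
        _ ≤ 1 * ρ ^ (j - 1) := mul_le_mul_of_nonneg_right hρ1 (pow_nonneg hρ _)
        _ = ρ ^ (j - 1) := one_mul _
  have hcVL : 0 ≤ cV + cL := by positivity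
  have h1 := mul_le_mul_of_nonneg_left hpow (mul_nonneg hcVL ha₀)
  nlinarith

end Majorants

/-! ## §2 Polynomial times geometric is bounded -/

/-- `ρ^m ≤ exp(−(1−ρ)m)` for `0 ≤ ρ`. -/
theorem pow_le_exp_neg (ρ : ℝ) (hρ : 0 ≤ ρ) (m : ℕ) : ρ ^ m ≤ Real.exp (-((1 - ρ) * m)) := by
  have h1 : ρ ≤ Real.exp (ρ - 1) := by have := Real.add_one_le_exp (ρ - 1); linarith
  calc ρ ^ m ≤ Real.exp (ρ - 1) ^ m := pow_le_pow_left₀ hρ h1 m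
    _ = Real.exp (-((1 - ρ) * m)) := by rw [← Real.exp_nat_mul]; congr 1; ring

/-- **`(j+1)²·ρ^(j−1) ≤ 9 + 16/(1−ρ)²`** for `0 ≤ ρ < 1` and `j ≥ 1`. -/
theorem sq_mul_pow_le {ρ : ℝ} (hρ0 : 0 ≤ ρ) (hρ1 : ρ < 1) {j : ℕ} (hj : 1 ≤ j) :
    ((j : ℝ) + 1) ^ 2 * ρ ^ (j - 1) ≤ 9 + 16 / (1 - ρ) ^ 2 := by
  have h1ρ : 0 < 1 - ρ := by linarith
  have hpowle1 : ρ ^ (j - 1) ≤ 1 := pow_le_one₀ hρ0 hρ1.le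
  have hK : 0 ≤ 16 / (1 - ρ) ^ 2 := by positivity
  rcases Nat.lt_or_ge j 3 with hj3 | hj3
  · -- `j = 1, 2`: `(j+1)² ≤ 9`
    have hjle : (j : ℝ) + 1 ≤ 3 := by
      have : j ≤ 2 := by omega
      have : (j : ℝ) ≤ 2 := by exact_mod_cast this
      linarith
    have hj0 : 0 ≤ (j : ℝ) + 1 := by positivity
    calc ((j : ℝ) + 1) ^ 2 * ρ ^ (j - 1) ≤ 3 ^ 2 * 1 :=
          mul_le_mul (pow_le_pow_left₀ hj0 hjle 2) hpowle1 (pow_nonneg hρ0 _) (by norm_num)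
      _ ≤ 9 + 16 / (1 - ρ) ^ 2 := by linarith
  · -- `j ≥ 3`: `(j+1)² ≤ 4 (j−1)²` and `(j−1)² ρ^(j−1) ≤ 4/(1−ρ)²`
    set m : ℕ := j - 1 with hm
    have hm2 : 2 ≤ m := by omega
    have hmj : (j : ℝ) = m + 1 := by
      have : j = m + 1 := by omega
      rw [this]; push_cast; ring
    have hmr : (2:ℝ) ≤ m := by exact_mod_cast hm2
    -- `(j+1)² ≤ 4 m²`
    have hsq : ((j : ℝ) + 1) ^ 2 ≤ 4 * (m : ℝ) ^ 2 := by rw [hmj]; nlinarith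
    -- `m² ρ^m ≤ m² e^{−(1−ρ)m} ≤ 4/(1−ρ)²`
    have hexp := pow_le_exp_neg ρ hρ0 m
    have hu : (1 - ρ) * m / 2 * Real.exp (-((1 - ρ) * m / 2)) ≤ 1 := by
      have h := Real.add_one_le_exp ((1 - ρ) * m / 2)
      have hpos := Real.exp_pos (-((1 - ρ) * m / 2))
      have e : Real.exp ((1 - ρ) * m / 2) * Real.exp (-((1 - ρ) * m / 2)) = 1 := by
        rw [← Real.exp_add, add_neg_cancel, Real.exp_zero]
      nlinarith [mul_le_mul_of_nonneg_right h hpos.le]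
    have hkey : (m : ℝ) ^ 2 * ρ ^ m ≤ 4 / (1 - ρ) ^ 2 := by
      have h2 : (m : ℝ) ^ 2 * Real.exp (-((1 - ρ) * m)) ≤ 4 / (1 - ρ) ^ 2 := by
        -- `m² e^{−(1−ρ)m} = (4/(1−ρ)²) · (u e^{−u})²` with `u = (1−ρ)m/2`
        have e : (m : ℝ) ^ 2 * Real.exp (-((1 - ρ) * m)) =
            4 / (1 - ρ) ^ 2 * ((1 - ρ) * m / 2 * Real.exp (-((1 - ρ) * m / 2))) ^ 2 := by
          rw [mul_pow, ← Real.exp_nat_mul]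
          field_simp
          ring_nf
        rw [e]
        have hv0 : 0 ≤ (1 - ρ) * m / 2 * Real.exp (-((1 - ρ) * m / 2)) := by positivity
        have hv1 : ((1 - ρ) * m / 2 * Real.exp (-((1 - ρ) * m / 2))) ^ 2 ≤ 1 := pow_le_one₀ hv0 hu
        calc 4 / (1 - ρ) ^ 2 * ((1 - ρ) * m / 2 * Real.exp (-((1 - ρ) * m / 2))) ^ 2 ≤ 4 / (1 - ρ) ^ 2 * 1 :=
              mul_le_mul_of_nonneg_left hv1 (by positivity)
          _ = 4 / (1 - ρ) ^ 2 := mul_one _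
      exact (mul_le_mul_of_nonneg_left hexp (sq_nonneg _)).trans h2
    calc ((j : ℝ) + 1) ^ 2 * ρ ^ (j - 1) ≤ 4 * (m : ℝ) ^ 2 * ρ ^ m := mul_le_mul_of_nonneg_right hsq (pow_nonneg hρ0 _)
      _ = 4 * ((m : ℝ) ^ 2 * ρ ^ m) := by ring
      _ ≤ 4 * (4 / (1 - ρ) ^ 2) := mul_le_mul_of_nonneg_left hkey (by norm_num)
      _ ≤ 9 + 16 / (1 - ρ) ^ 2 := by rw [show 4 * (4 / (1 - ρ) ^ 2) = 16 / (1 - ρ) ^ 2 by ring]; linarith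

end Summit.AnomalousDissipation.AnomalousDissipation.Theorems.SolenoidalFractalHomogenisation.LagrangianStep.VmodGen

end
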